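import Summits.QuantumFields.YangMills.Theorems.AlphaInputsT3ACv2Rec
import Summits.QuantumFields.YangMills.Theorems.AlphaInputsT3ACv2Data
import HarnessLib

/-!
# `AlphaInputsT3ACv2RecData` — THE v2 DATUM AT GIVEN [Balaban1985Variational] CONSTANTS (`OfV2At.dataT3c`) and its delivered schemas — the
# ADAPTER-FACING form (owner RULING g17-№1 §D(3): the route's lines name `AlphaInputsT3ACv2Rec L`, which hands a record `𝔠` and family-UNIFORM
# constants `a₀, a₁` with `OfV2At F 𝔠 a₀ a₁` for every family)

Lane `pub-balaban3d`, seat alpha-1.  `AlphaInputsT3ACv2Data` (previous-but-one file) proved everything for the `∃`-form `OfV2 F 𝔠`, whose constants are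
CHOSEN per family; THIS FILE repeats the datum and the proofs verbatim for the given-constants form `OfV2At F 𝔠 a₀ a₁` (record `OfV2At.pkgAtV2` with
`pkgAtV2_a₀ = a₀`), so that the `UminTrivIsRegMinimiser` clauses are delivered with the adapter's OWN `a₀, a₁` (`dataT3c_uminTriv`: hypotheses
`θBal(n) ≤ a₁`, `B₃θBal(n) ≤ ε₀ ≤ a₀`).  Delivered: `Constraint42Top`, `Regularity68Levels`/`Regularity68`, `MainTermIsAction`, `AdmOnSmall` (record's
`b₀, p₀`), the `UminTrivIsRegMinimiser` clauses at every `n < K`, `Ineq41AE`/`Ineq47AE` and `EnvelopeRegular` at every `j ≤ K`, `ChiRange`, `TrivRegions`,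
`RmSize`, `EcstBook` (i), `χ` = window indicator / `NoTrivOnLarge` (1).  Not delivered (as before): polymer clauses (F-α1-5), `PintSize`, `EcstBook` (ii),
`RepAtHeights` as typed, the `n = K` clause (F-α1-6), 18916's large-field clauses; `LFShape` not claimed (floored trivial mass outside `ChargedT3`,
owner g17 (A): «window the floor», next lane task).  CONDITIONAL on the package; nothing of [Balaban1985UV3]/[Balaban1985Variational] is asserted.

References: T. Bałaban, Commun. Math. Phys. 102 (1985) 255–275 [Balaban1985UV3], (40)–(43) p.266, (47) p.267, (62)–(68) pp.271–273, Thm 2 p.272;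
Commun. Math. Phys. 102 (1985) 277–309 [Balaban1985Variational], (6)–(8) and Thm 1 p.278–279, Prop 7 p.299.
-/

set_option autoImplicit false

noncomputable section

namespace Summit.QuantumFields.YangMills.Theorems

open MeasureTheory
open Literature.MathematicalPhysics.QuantumFieldTheory.Balaban1983to89
open Literature.MathematicalPhysics.QuantumFieldTheory.Balaban1983to89.T3ContinuumYM3Torus
open Literature.MathematicalPhysics.QuantumFieldTheory.Balaban1983to89.T3UnitLawDensityEML (ℰp)
open Literature.MathematicalPhysics.QuantumFieldTheory.Balaban1983to89.T3UnitScaleTilt (θBal)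
open Literature.MathematicalPhysics.QuantumFieldTheory.Balaban1983to89.T3LevelShift (fieldShift)
open Literature.MathematicalPhysics.QuantumFieldTheory.Balaban1983to89.T3PrintedRegularMinimiser (regFibrePr minActionRegPr)
open Literature.MathematicalPhysics.QuantumFieldTheory.Balaban1983to89.T3AlphaInputsAC
open Literature.MathematicalPhysics.QuantumFieldTheory.Balaban1985CMP102
open Literature.MathematicalPhysics.QuantumFieldTheory.Balaban1985CMP102.Setting
open Summit.QuantumFields.Balaban3D.Carriers
open Summit.QuantumFields.Balaban3D.Proofs.Primitives
open Summit.QuantumFields.Balaban3D.Proofs.TowerAC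
open Summit.QuantumFields.Balaban3D.Proofs.StandardAC
open Summit.QuantumFields.Balaban3D.Proofs.InputsAC
open Summit.QuantumFields.Balaban3D.Proofs.TowerFactsAC

/-! ## §1 The datum at given constants -/

variable {F : T3Family} {𝔠 : AlphaConsts F.L (suGroupModel 2).N} {a₀ a₁ : ℝ}

/-- **THE VERSION-2 PACKAGE'S DATA ASSEMBLED, WITH PRINT'S (40) SUPPORT AS `Adm`**: run-`K` fields := the objects of the AC tower of the chosen
record `h.pkgAtV2 hc γ hγ hγ1 K` (as part 2's `dataT3`: histories/regions the lane's, `LF`/`mainT`/`Pint`/`Zterm`/`χ`/`Estep`/`Rm` the tower's,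
`Umin := U_k(·,h)`, `Ecst K j := E_j − E`), polymer fields the parameter `π`, and `Adm K j h W := ChargedT3 … (avgWindowFactor L) … j h W` ([Balaban1985UV3]
(40) p.266, window factor the lane's averaging constant).  A DEFINITION; nothing is asserted. [cite: Balaban1985UV3, (38)-(43) p.266 and (47) p.267] -/
def AlphaInputsT3AC.OfV2At.dataT3c (h : AlphaInputsT3AC.OfV2At F 𝔠 a₀ a₁) (hc : 0 < a₀ ∧ 0 < a₁ ∧ 𝔠.B₃ * a₁ ≤ a₀)
    (γ : ℝ) (hγ : 0 < γ) (hγ1 : γ ≤ (min 𝔠.gamma0 1) ^ 2) (π : AlphaInputsT3AC.PolymerT3 F) : AlphaDataT3 F γ where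
  Hist := fun K j => Hist (F.P K) j
  triv := fun K j => Hist.triv (F.P K) j
  Ω := fun K j hh i => Omega 𝔠.lane.carrier.M₁
    (rcolOf (T3Scales F γ hγ (hγ1.trans (sq_min_one_le _ 𝔠.gamma0_pos)) K) 𝔠.lane.carrier) j hh i
  Adm := fun K j hh W => ChargedT3 F γ 𝔠.b₀ 𝔠.p₀ (avgWindowFactor F.L) K 𝔠.lane.carrier.M₁
    (rcolOf (T3Scales F γ hγ (hγ1.trans (sq_min_one_le _ 𝔠.gamma0_pos)) K) 𝔠.lane.carrier) j hh W
  LF := fun K j W Φ => (h.pkgAtV2 hc γ hγ hγ1 K).T.LF j W Φ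
  Umin := fun K j hh W => (h.pkgAtV2 hc γ hγ hγ1 K).UkH j hh W
  mainT := fun K j hh W => (h.pkgAtV2 hc γ hγ hγ1 K).T.mainT j hh W
  Pint := fun K j hh W => (h.pkgAtV2 hc γ hγ hγ1 K).T.Pint j hh W
  Loc := π.Loc
  Pterm := π.Pterm
  enl := π.enl
  treeLen := π.treeLen
  Zterm := fun K j hh => (h.pkgAtV2 hc γ hγ hγ1 K).T.Zterm j hh
  χ := fun K j W => (h.pkgAtV2 hc γ hγ hγ1 K).T.χ j W
  Estep := fun K i => (h.pkgAtV2 hc γ hγ hγ1 K).T.Estep i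
  Ecst := fun K j => (h.pkgAtV2 hc γ hγ hγ1 K).T.Ecst j - (h.pkgAtV2 hc γ hγ hγ1 K).E
  Rm := fun K j => (h.pkgAtV2 hc γ hγ hγ1 K).T.Rm j

section Delivered

variable (h : AlphaInputsT3AC.OfV2At F 𝔠 a₀ a₁) (hc : 0 < a₀ ∧ 0 < a₁ ∧ 𝔠.B₃ * a₁ ≤ a₀) (γ : ℝ) (hγ : 0 < γ)
  (hγ1 : γ ≤ (min 𝔠.gamma0 1) ^ 2) (π : AlphaInputsT3AC.PolymerT3 F)

/-! ## §2 The minimiser rows delivered (C1, C2, r1 at `n < K`, the main term, `AdmOnSmall`) -/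

/-- **`Constraint42Top` — PROVED from r2** ((42) p.266 / (67) p.273 at the top level, torus-iterate form, on print's (40) support).
[cite: Balaban1985UV3, (42) p.266 and (67) p.273] -/
theorem AlphaInputsT3AC.OfV2At.dataT3c_constraint42Top : Constraint42Top (h.dataT3c hc γ hγ hγ1 π) :=
  fun K j hh W hj hadm b hb => (h.pkgAtV2 hc γ hγ hγ1 K).constraint42 j hj hh W hadm b hb

/-- **`Regularity68Levels` — PROVED from r3** ((68) p.273, multi-level T³ form, on print's (40) support). [cite: Balaban1985UV3, (68) p.273] -/
theorem AlphaInputsT3AC.OfV2At.dataT3c_regularity68Levels : Regularity68Levels (h.dataT3c hc γ hγ hγ1 π) 𝔠.b₀ 𝔠.p₀ 𝔠.C68 :=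
  fun K j hh W hj hadm i hi s hs q hq => (h.pkgAtV2 hc γ hγ hγ1 K).regularity68Levels j hj hh W hadm i hi s hs q hq

/-- **`Regularity68`** (the `s = 0` instance, `T3AlphaInputsAC.regularity68_of_levels`). [cite: Balaban1985UV3, (68) p.273] -/
theorem AlphaInputsT3AC.OfV2At.dataT3c_regularity68 : Regularity68 (h.dataT3c hc γ hγ hγ1 π) 𝔠.b₀ 𝔠.p₀ 𝔠.C68 :=
  regularity68_of_levels (h.dataT3c_regularity68Levels hc γ hγ hγ1 π)

/-- **`MainTermIsAction`** — EXACT (`PkgAt.mainT_eq`: `(1/g_j²)η⁻¹ = β_K`). [cite: Balaban1985UV3, (5) p.256 and (41) p.266] -/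
theorem AlphaInputsT3AC.OfV2At.dataT3c_mainTermIsAction : MainTermIsAction (h.dataT3c hc γ hγ hγ1 π) :=
  fun K j hh W => (h.pkgAtV2 hc γ hγ hγ1 K).toPkgAt.mainT_eq j hh W

/-- **THE `UminTrivIsRegMinimiser` CLAUSES AT A HEIGHT `n < K` — PROVED from r1**: if `θBal(n) ≤ a₁` and `B₃θBal(n) ≤ ε₀ ≤ a₀` (the GIVEN
constants `a₀`, `a₁` — uniform in the family, `γ`, `K`; an adapter discharges these by `T3ThresholdSmallness` once `γ ≤ γ₁(ε₀)`), then for every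
`θBal(n)`-small datum `V` the composite minimiser at the trivial history, read `n` levels up, lies in print's space (6) of radius `ε₀` over `V` and
attains `minActionRegPr` there.  (At `n = K` the interface's clause concerns the datum itself — not a minimiser statement, finding F-α1-6.)
[cite: Balaban1985Variational, Thm 1 (8) p.279 and Prop 7 p.299] -/
theorem AlphaInputsT3AC.OfV2At.dataT3c_uminTriv (K n : ℕ) (hnK : n < K) (ε₀ : ℝ)
    (ha₁ : θBal F.L γ 𝔠.b₀ 𝔠.p₀ n ≤ a₁) (hlo : 𝔠.B₃ * θBal F.L γ 𝔠.b₀ 𝔠.p₀ n ≤ ε₀) (hhi : ε₀ ≤ a₀)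
    (V : GaugeField (F.P n) 0 (Matrix.specialUnitaryGroup (Fin 2) ℂ)) (hV : PlaqSmall (θBal F.L γ 𝔠.b₀ 𝔠.p₀ n) V) :
    (h.dataT3c hc γ hγ hγ1 π).Umin K (K - n) ((h.dataT3c hc γ hγ hγ1 π).triv K (K - n))
        (fieldShift (F.sitesPerDir_eq (m := F.m) (K := K) (j := K - n) (m' := F.m) (K' := n) (j' := 0) (by omega)) V) ∈
      regFibrePr F n K hnK.le ε₀ V ∧
    wilsonAction4 ((h.dataT3c hc γ hγ hγ1 π).Umin K (K - n) ((h.dataT3c hc γ hγ hγ1 π).triv K (K - n))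
        (fieldShift (F.sitesPerDir_eq (m := F.m) (K := K) (j := K - n) (m' := F.m) (K' := n) (j' := 0) (by omega)) V)) =
      minActionRegPr F n K hnK.le ε₀ V := by
  have hθ : 0 < θBal F.L γ 𝔠.b₀ 𝔠.p₀ n := by
    have := (h.pkgAtV2 hc γ hγ hγ1 K).toPkgAt.θBal_pos (K - n) (by omega)
    rwa [show K - (K - n) = n by omega] at this
  have ha₁' : θBal F.L γ 𝔠.b₀ 𝔠.p₀ n ≤ (h.pkgAtV2 hc γ hγ hγ1 K).a₁ := by rw [h.pkgAtV2_a₁ hc]; exact ha₁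
  have hhi' : ε₀ ≤ (h.pkgAtV2 hc γ hγ hγ1 K).a₀ := by rw [h.pkgAtV2_a₀ hc]; exact hhi
  exact ⟨(h.pkgAtV2 hc γ hγ hγ1 K).uminTriv_mem_regFibrePr hnK hθ ha₁' hlo hhi' V hV,
    (h.pkgAtV2 hc γ hγ hγ1 K).uminTriv_action_eq hnK hθ ha₁' hlo hhi' V hV⟩

/-- **`AdmOnSmall` AT THE RECORD'S `b₀, p₀` — PROVED**: a `θBal(K − j)`-small datum is charged at the trivial history (the trivial history is
admissible, `Carriers.Hist.admissible_triv`, its top region is the torus, and the route's window sits inside print's (40) window,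
`θBal_le_two_mul_sq_mul_θBal_succ`). [cite: Balaban1985UV3, (40) p.266 and (47) p.267] -/
theorem AlphaInputsT3AC.OfV2At.dataT3c_admOnSmall : AdmOnSmall (h.dataT3c hc γ hγ hγ1 π) 𝔠.b₀ 𝔠.p₀ := by
  intro K j W _ hW
  refine ⟨Hist.admissible_triv _ _ j, fun p _ => (hW p).trans_le ?_⟩
  have hγ1' : γ ≤ 1 := hγ1.trans (sq_min_one_le _ 𝔠.gamma0_pos)
  have hmono := θBal_le_two_mul_sq_mul_θBal_succ (le_of_lt F.hL.2) hγ hγ1' 𝔠.b₀_pos 𝔠.p₀_pos.le (K - j)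
  have hθ : 0 ≤ θBal F.L γ 𝔠.b₀ 𝔠.p₀ (K - j + 1) :=
    (T3MinimiserStabilityReduction.θBal_pos (le_of_lt F.hL.2) hγ hγ1' 𝔠.b₀_pos 𝔠.p₀ (K - j + 1)).le
  have hB : 1 ≤ avgWindowFactor F.L := by
    unfold avgWindowFactor
    have hL : (1 : ℝ) ≤ F.L := by exact_mod_cast (le_of_lt F.hL.2)
    have h5 : (0 : ℝ) ≤ (((3 + 2) * F.L : ℕ) : ℝ) ^ 2 := sq_nonneg _
    nlinarith
  have hL2 : (0 : ℝ) ≤ 2 * (F.L : ℝ) ^ 2 := by positivity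
  calc θBal F.L γ 𝔠.b₀ 𝔠.p₀ (K - j) ≤ 2 * (F.L : ℝ) ^ 2 * θBal F.L γ 𝔠.b₀ 𝔠.p₀ (K - j + 1) := hmono
    _ = 2 * (F.L : ℝ) ^ 2 * 1 * θBal F.L γ 𝔠.b₀ 𝔠.p₀ (K - j + 1) := by ring
    _ ≤ 2 * (F.L : ℝ) ^ 2 * avgWindowFactor F.L * θBal F.L γ 𝔠.b₀ 𝔠.p₀ (K - j + 1) :=
        mul_le_mul_of_nonneg_right (mul_le_mul_of_nonneg_left hB hL2) hθ

/-! ## §3 The sandwich, the characteristic function, the sizes, the bookkeeping -/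

/-- **(41)′ a.e., every `j ≤ K`** (`PkgAt.resDensity_le_ae`). [cite: Balaban1985UV3, (41) p.266 and Thm 2 p.272] -/
theorem AlphaInputsT3AC.OfV2At.dataT3c_ineq41AE (K j : ℕ) (hj : j ≤ K) : Ineq41AE (h.dataT3c hc γ hγ hγ1 π) K j :=
  (h.pkgAtV2 hc γ hγ hγ1 K).toPkgAt.resDensity_le_ae j hj

/-- **(47)′ a.e., every `j ≤ K`** (`PkgAt.le_resDensity_ae`). [cite: Balaban1985UV3, (47) p.267 and Thm 2 p.272] -/
theorem AlphaInputsT3AC.OfV2At.dataT3c_ineq47AE (K j : ℕ) (hj : j ≤ K) : Ineq47AE (h.dataT3c hc γ hγ hγ1 π) K j :=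
  (h.pkgAtV2 hc γ hγ hγ1 K).toPkgAt.le_resDensity_ae j hj

/-- **`ChiRange`**. [cite: Balaban1985UV3, (47) p.267] -/
theorem AlphaInputsT3AC.OfV2At.dataT3c_chiRange : ChiRange (h.dataT3c hc γ hγ hγ1 π) := fun K j W =>
  ⟨chi_towerOfAC_nonneg 𝔠.lane (h.pkgAtV2 hc γ hγ hγ1 K).X (h.pkgAtV2 hc γ hγ hγ1 K).𝔖 j W,
    chi_towerOfAC_le_one 𝔠.lane (h.pkgAtV2 hc γ hγ hγ1 K).X (h.pkgAtV2 hc γ hγ hγ1 K).𝔖 j W⟩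

/-- **`TrivRegions`** (`Carriers.Omega_triv`). [cite: Balaban1985UV3, (47) p.267 and p.272] -/
theorem AlphaInputsT3AC.OfV2At.dataT3c_trivRegions : TrivRegions (h.dataT3c hc γ hγ hγ1 π) := fun _ j i =>
  Omega_triv _ _ j i

/-- **The `EcstBook` identity** (clause (i)): `Ecst K j = −Σ_{i<j} Estep K i` for `j ≤ K`. [cite: Balaban1985UV3, (62) p.271 and (64) p.273] -/
theorem AlphaInputsT3AC.OfV2At.dataT3c_Ecst_eq (K j : ℕ) (hj : j ≤ K) :
    (h.dataT3c hc γ hγ hγ1 π).Ecst K j = -∑ i ∈ Finset.range j, (h.dataT3c hc γ hγ hγ1 π).Estep K i :=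
  (h.pkgAtV2 hc γ hγ hγ1 K).toPkgAt.Ecst_sub_E_eq j hj

/-- **`RmSize`** with `C = r⋆γ^{3+κ₀}`, `q = L^{−κ₀}` (closed form `PkgAt.Rm_eq`). [cite: Balaban1985UV3, (41) p.266 and (5) p.256] -/
theorem AlphaInputsT3AC.OfV2At.dataT3c_rmSize :
    RmSize (h.dataT3c hc γ hγ hγ1 π) (𝔠.stepConsts.rstar * γ ^ (3 + 𝔠.κ₀)) (((F.L : ℝ)⁻¹) ^ 𝔠.κ₀) := by
  have hL1 : (1 : ℝ) < F.L := by exact_mod_cast F.hL.2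
  have hLi : (0 : ℝ) ≤ (F.L : ℝ)⁻¹ := inv_nonneg.mpr (zero_lt_one.trans hL1).le
  have hq0 : 0 ≤ ((F.L : ℝ)⁻¹) ^ 𝔠.κ₀ := Real.rpow_nonneg hLi _
  refine ⟨hq0, Real.rpow_lt_one hLi (inv_lt_one_of_one_lt₀ hL1) 𝔠.κ₀_pos, fun K j hj => ?_⟩
  have heq : (h.dataT3c hc γ hγ hγ1 π).Rm K j = 𝔠.stepConsts.rstar * γ ^ (3 + 𝔠.κ₀) *
      (∑ i ∈ Finset.range j, (((F.L : ℝ)⁻¹) ^ 𝔠.κ₀) ^ (K - i)) * (2 * (F.L : ℝ) ^ F.m) ^ 3 :=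
    (h.pkgAtV2 hc γ hγ hγ1 K).toPkgAt.Rm_eq j hj
  refine ⟨?_, heq.le⟩
  rw [heq]
  have h3 : 0 ≤ ∑ i ∈ Finset.range j, (((F.L : ℝ)⁻¹) ^ 𝔠.κ₀) ^ (K - i) := Finset.sum_nonneg fun i _ => pow_nonneg hq0 _
  have h4 : 0 ≤ (2 * (F.L : ℝ) ^ F.m) ^ 3 := by positivity
  exact mul_nonneg (mul_nonneg (mul_nonneg 𝔠.stepConsts.rstar_nonneg (Real.rpow_nonneg hγ.le _)) h3) h4

/-- **`χ_j` IS THE INDICATOR OF THE ROUTE'S WINDOW** (`PkgAt.eps1_eq`): `χ^{(K)}_j = chiSmall univ (θBal (K − j))`, `j ≤ K`.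
[cite: Balaban1985UV3, (47) p.267] -/
theorem AlphaInputsT3AC.OfV2At.dataT3c_chi_eq (K j : ℕ) (hj : j ≤ K) (W : GaugeField (F.P K) j (Matrix.specialUnitaryGroup (Fin 2) ℂ)) :
    (h.dataT3c hc γ hγ hγ1 π).χ K j W = chiSmall Set.univ (θBal F.L γ 𝔠.b₀ 𝔠.p₀ (K - j)) W := by
  rw [← (h.pkgAtV2 hc γ hγ hγ1 K).toPkgAt.eps1_eq j hj]
  rfl

/-- **`NoTrivOnLarge` clause 1 with `Cχ = 1`**: one plaquette at distance `≥ θBal(K − j)` from `1` kills `χ_j`. [cite: Balaban1985UV3, (47) p.267] -/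
theorem AlphaInputsT3AC.OfV2At.dataT3c_chi_eq_zero_of_le (K j : ℕ) (hj : j ≤ K)
    (W : GaugeField (F.P K) j (Matrix.specialUnitaryGroup (Fin 2) ℂ)) (q : Plaq (F.P K) j)
    (hq : 1 * θBal F.L γ 𝔠.b₀ 𝔠.p₀ (K - j) ≤ GaugeGroup.dist1 (GaugeField.plaqHol W q)) :
    (h.dataT3c hc γ hγ hγ1 π).χ K j W = 0 := by
  rw [h.dataT3c_chi_eq hc γ hγ hγ1 π K j hj W]
  unfold chiSmall
  rw [if_neg]
  intro hsmall
  have hlt := hsmall q (Set.mem_univ q)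
  linarith

/-- On the window the minorant is positive: `0 < low_j(W)` for `θBal(K − j)`-small `W`. [cite: Balaban1985UV3, (47) p.267] -/
theorem AlphaInputsT3AC.OfV2At.dataT3c_low_pos_of_plaqSmall (K j : ℕ) (hj : j ≤ K)
    (W : GaugeField (F.P K) j (Matrix.specialUnitaryGroup (Fin 2) ℂ)) (hW : PlaqSmall (θBal F.L γ 𝔠.b₀ 𝔠.p₀ (K - j)) W) :
    0 < (h.dataT3c hc γ hγ hγ1 π).low K j W := by
  unfold AlphaDataT3.low
  rw [h.dataT3c_chi_eq hc γ hγ hγ1 π K j hj W]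
  unfold chiSmall
  rw [if_pos (show PlaqSmallOn Set.univ (θBal F.L γ 𝔠.b₀ 𝔠.p₀ (K - j)) W from fun q _ => hW q), one_mul]
  exact Real.exp_pos _

/-! ## §4 `EnvelopeRegular` AT EVERY `j ≤ K` (step rows below the top, terminal rows at the top) -/

/-- **`up_j` integrable, every `j ≤ K`**. [cite: Balaban1985UV3, (41) p.266] -/
theorem AlphaInputsT3AC.OfV2At.dataT3c_integrable_up (K j : ℕ) (hj : j ≤ K) :
    Integrable ((h.dataT3c hc γ hγ hγ1 π).up K j) (fieldMeasure (F.P K) j (Matrix.specialUnitaryGroup (Fin 2) ℂ)) := by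
  show Integrable (fun W => ∑ hh : Hist (F.P K) j,
    (inputOfAC 𝔠.lane (h.pkgAtV2 hc γ hγ hγ1 K).X (h.pkgAtV2 hc γ hγ hγ1 K).𝔖).W.mass j hh W *
      Real.exp (-((h.pkgAtV2 hc γ hγ hγ1 K).T.mainT j hh W) + (h.pkgAtV2 hc γ hγ hγ1 K).T.Pint j hh W +
        (h.pkgAtV2 hc γ hγ hγ1 K).T.Zterm j hh)) _
  rcases Nat.lt_or_eq_of_le hj with hlt | heq
  · have st := (h.pkgAtV2 hc γ hγ hγ1 K).run.steps j hlt
    exact (h.pkgAtV2 hc γ hγ hγ1 K).toPkgAt.integrable_up_of_rows j st.hU st.hPm _ st.hPb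
  · subst heq
    exact (h.pkgAtV2 hc γ hγ hγ1 j).toPkgAt.integrable_up_of_rows j (h.pkgAtV2 hc γ hγ hγ1 j).terminal_measurable_UkH
      (h.pkgAtV2 hc γ hγ hγ1 j).terminal_measurable_Pint _ (h.pkgAtV2 hc γ hγ hγ1 j).terminal_Pint_le

/-- **`low_j` integrable, every `j ≤ K`**. [cite: Balaban1985UV3, (47) p.267] -/
theorem AlphaInputsT3AC.OfV2At.dataT3c_integrable_low (K j : ℕ) (hj : j ≤ K) :
    Integrable ((h.dataT3c hc γ hγ hγ1 π).low K j) (fieldMeasure (F.P K) j (Matrix.specialUnitaryGroup (Fin 2) ℂ)) := by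
  show Integrable (fun W => (h.pkgAtV2 hc γ hγ hγ1 K).T.χ j W *
    Real.exp (-((h.pkgAtV2 hc γ hγ hγ1 K).T.mainT j (Hist.triv (F.P K) j) W) +
      (h.pkgAtV2 hc γ hγ hγ1 K).T.Pint j (Hist.triv (F.P K) j) W)) _
  rcases Nat.lt_or_eq_of_le hj with hlt | heq
  · have st := (h.pkgAtV2 hc γ hγ hγ1 K).run.steps j hlt
    exact (h.pkgAtV2 hc γ hγ hγ1 K).toPkgAt.integrable_low_of_rows j (st.hU _) (st.hPm _) _ (st.hPb _)
  · subst heq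
    exact (h.pkgAtV2 hc γ hγ hγ1 j).toPkgAt.integrable_low_of_rows j ((h.pkgAtV2 hc γ hγ hγ1 j).terminal_measurable_UkH _)
      ((h.pkgAtV2 hc γ hγ hγ1 j).terminal_measurable_Pint _) _ ((h.pkgAtV2 hc γ hγ hγ1 j).terminal_Pint_le _)

/-- **`0 < ∫ low_j`, every `j ≤ K`** (open non-empty charged window + `IsOpenPosMeasure` of product Haar measure, part 4). [cite: Balaban1985UV3, (47) p.267] -/
theorem AlphaInputsT3AC.OfV2At.dataT3c_integral_low_pos (K j : ℕ) (hj : j ≤ K) :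
    0 < ∫ W, (h.dataT3c hc γ hγ hγ1 π).low K j W ∂fieldMeasure (F.P K) j (Matrix.specialUnitaryGroup (Fin 2) ℂ) := by
  have hχ := h.dataT3c_chiRange hc γ hγ hγ1 π
  rw [integral_pos_iff_support_of_nonneg_ae (ae_of_all _ fun W => low_nonneg hχ K j W) (h.dataT3c_integrable_low hc γ hγ hγ1 π K j hj)]
  have hθ : 0 < θBal F.L γ 𝔠.b₀ 𝔠.p₀ (K - j) := (h.pkgAtV2 hc γ hγ hγ1 K).toPkgAt.θBal_pos j hj
  refine lt_of_lt_of_le (fieldMeasure_plaqSmall_pos (P := F.P K) (j := j) hθ) (measure_mono fun W hW => ?_)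
  exact Function.mem_support.mpr (ne_of_gt (h.dataT3c_low_pos_of_plaqSmall hc γ hγ hγ1 π K j hj W hW))

/-- **`EnvelopeRegular` AT EVERY LEVEL `j ≤ K`** — the interface's regularity clause IN FULL for the version-2 datum (part 4 stopped at `j < K`;
the terminal rows supply the top level). [cite: Balaban1985UV3, (41) p.266 and (47) p.267] -/
theorem AlphaInputsT3AC.OfV2At.dataT3c_envelopeRegular (K j : ℕ) (hj : j ≤ K) : EnvelopeRegular (h.dataT3c hc γ hγ hγ1 π) K j :=
  ⟨h.dataT3c_integrable_low hc γ hγ hγ1 π K j hj, h.dataT3c_integrable_up hc γ hγ hγ1 π K j hj, h.dataT3c_integral_low_pos hc γ hγ hγ1 π K j hj⟩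

/-- **THE PACKAGE'S SANDWICH-AND-REGULARITY CLAUSE IN FULL**: `∀ K j, j ≤ K → Ineq41AE ∧ Ineq47AE ∧ EnvelopeRegular` for the version-2 datum.
[cite: Balaban1985UV3, Thm 2 p.272] -/
theorem AlphaInputsT3AC.OfV2At.dataT3c_sandwich_regular (K j : ℕ) (hj : j ≤ K) :
    Ineq41AE (h.dataT3c hc γ hγ hγ1 π) K j ∧ Ineq47AE (h.dataT3c hc γ hγ hγ1 π) K j ∧ EnvelopeRegular (h.dataT3c hc γ hγ hγ1 π) K j :=
  ⟨h.dataT3c_ineq41AE hc γ hγ hγ1 π K j hj, h.dataT3c_ineq47AE hc γ hγ hγ1 π K j hj, h.dataT3c_envelopeRegular hc γ hγ hγ1 π K j hj⟩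

end Delivered

end Summit.QuantumFields.YangMills.Theorems

end
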